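import Summits.Ventures.PercRepro.RankLevelSetRuleQHallSlices

/-!
# PercRepro — THE DEFICIT FORM OF RULE Q'S DOUBLE COUNT: THE UP-HALL CONDITION OF C-044 AT THE TIGHT LAYER UP TO THE TOTAL
DEFICIT OF THE UNPAID MEMBERS (night-1, gen 19; dossier §30.7)

Rule Q's equal split loads every `S ∈ Y` with exactly one unit, so the receipts of any subfamily `𝒜` of members add up to at
most the number of `Y`-sets above `𝒜` — with NO hypothesis at all (`sum_ruleQRecv_le_upNbhd`; the body of `hallUp_of_ruleQ` /
`hallUp_of_recv_on` without their step 1). Hence for EVERY subfamily `𝒜` of members of every cell `(p, q)` of every finite matroid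
  `Φ(p, q) · #𝒜 ≤ #N⁺(𝒜) + Σ_{Z ∈ 𝒜} (Φ(p, q) − recv(Z))₊`  (`hallUp_defect`):
the UP-Hall condition of C-044 holds up to the total deficit of the members Rule Q does not pay — on the families `k ≤ 7` the
members in the slices `2 ≤ q − #P ≤ k − 3` (`rhat_slice_iff_le_seven`), and only they, can contribute to the sum
(`hallUp_defect_slices`). Axioms: standard.
-/

namespace PercRepro

open Set Matroid Finset

variable {α : Type} (M : Matroid α) [M.Finite]

/-- **The receipts of a subfamily add up to at most its UP-neighbourhood**: for every finite family `𝒜f` of members of the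
cell `(p, q)`, `Σ_{Z ∈ 𝒜f} recv(Z) ≤ #N⁺(𝒜f)` — Rule Q's load of every `S ∈ Y` is exactly one unit (no hypothesis). -/
theorem sum_ruleQRecv_le_upNbhd (p q : ℕ) (𝒜f : Finset (Set α)) (h𝒜 : (𝒜f : Set (Set α)) ⊆ cellMembers M p q) :
    ∑ Z ∈ 𝒜f, ruleQRecv M p q Z ≤ ((upNbhd M p q (𝒜f : Set (Set α))).ncard : ℚ) := by
  classical
  set Yf : Finset (Set α) := (cellY_finite M p q).toFinset with hYf
  -- exchange the sums
  have h2 : ∑ Z ∈ 𝒜f, ruleQRecv M p q Z =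
      ∑ S ∈ Yf, ((𝒜f.filter (fun Z => Z ⊆ S)).card : ℚ) * (1 / (memCount M p q S : ℚ)) := by
    unfold ruleQRecv
    rw [← hYf, Finset.sum_comm]
    refine Finset.sum_congr rfl (fun S _ => ?_)
    simp only [Set.indicator_apply, Set.mem_setOf_eq]
    rw [Finset.sum_ite, Finset.sum_const_zero, add_zero, Finset.sum_const, nsmul_eq_mul]
  -- each term is at most the indicator of «S contains a member of 𝒜f»
  have h3 : ∀ S ∈ Yf, ((𝒜f.filter (fun Z => Z ⊆ S)).card : ℚ) * (1 / (memCount M p q S : ℚ)) ≤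
      (if ∃ Z ∈ (𝒜f : Set (Set α)), Z ⊆ S then (1 : ℚ) else 0) := by
    intro S _
    by_cases hex : ∃ Z ∈ (𝒜f : Set (Set α)), Z ⊆ S
    · rw [if_pos hex]
      have hle : (𝒜f.filter (fun Z => Z ⊆ S)).card ≤ memCount M p q S := by
        unfold memCount
        rw [← ncard_coe_finset]
        refine ncard_le_ncard ?_ ((cellMembers_finite M p q).subset (fun _ hZ => hZ.1))
        intro Z hZ
        rw [Finset.mem_coe, Finset.mem_filter] at hZ
        exact ⟨h𝒜 hZ.1, hZ.2⟩
      have hpos : 0 < memCount M p q S := by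
        obtain ⟨Z, hZ, hZS⟩ := hex
        have : (𝒜f.filter (fun Z => Z ⊆ S)).card ≠ 0 := by
          rw [Finset.card_ne_zero]
          exact ⟨Z, Finset.mem_filter.2 ⟨Finset.mem_coe.1 hZ, hZS⟩⟩
        omega
      have hposq : (0 : ℚ) < (memCount M p q S : ℚ) := by exact_mod_cast hpos
      rw [mul_one_div, div_le_one hposq]
      exact_mod_cast hle
    · rw [if_neg hex]
      have hzero : (𝒜f.filter (fun Z => Z ⊆ S)).card = 0 := by
        rw [Finset.card_eq_zero, Finset.filter_eq_empty_iff]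
        intro Z hZ hZS
        exact hex ⟨Z, Finset.mem_coe.2 hZ, hZS⟩
      rw [hzero]
      simp
  -- the indicators sum to the size of the UP-neighbourhood
  have h4 : ∑ S ∈ Yf, (if ∃ Z ∈ (𝒜f : Set (Set α)), Z ⊆ S then (1 : ℚ) else 0)
      = ((upNbhd M p q (𝒜f : Set (Set α))).ncard : ℚ) := by
    rw [Finset.sum_ite, Finset.sum_const_zero, add_zero, Finset.sum_const, nsmul_eq_mul, mul_one]
    have hU : upNbhd M p q (𝒜f : Set (Set α)) =
        ((Yf.filter (fun S => ∃ Z ∈ (𝒜f : Set (Set α)), Z ⊆ S) : Finset (Set α)) : Set (Set α)) := by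
      ext S
      rw [Finset.coe_filter, hYf, Set.mem_setOf_eq, (cellY_finite M p q).mem_toFinset]
      constructor
      · intro hS
        exact ⟨⟨hS.1, hS.2.1, hS.2.2.1⟩, hS.2.2.2⟩
      · intro hS
        exact ⟨hS.1.1, hS.1.2.1, hS.1.2.2, hS.2⟩
    rw [hU, ncard_coe_finset]
  calc ∑ Z ∈ 𝒜f, ruleQRecv M p q Z
      = ∑ S ∈ Yf, ((𝒜f.filter (fun Z => Z ⊆ S)).card : ℚ) * (1 / (memCount M p q S : ℚ)) := h2
    _ ≤ ∑ S ∈ Yf, (if ∃ Z ∈ (𝒜f : Set (Set α)), Z ⊆ S then (1 : ℚ) else 0) := Finset.sum_le_sum h3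
    _ = ((upNbhd M p q (𝒜f : Set (Set α))).ncard : ℚ) := h4

/-- **THE DEFICIT FORM OF THE UP-HALL CONDITION**: for EVERY finite family `𝒜f` of members of the cell `(p, q)`,
`Φ(p, q) · #𝒜f ≤ #N⁺(𝒜f) + Σ_{Z ∈ 𝒜f} (Φ(p, q) − recv(Z))₊` — the Hall condition holds up to the total deficit of the
members Rule Q's equal split does not pay. -/
theorem hallUp_defect (p q : ℕ) (𝒜f : Finset (Set α)) (h𝒜 : (𝒜f : Set (Set α)) ⊆ cellMembers M p q) :
    phiK p q * (𝒜f.card : ℚ) ≤ ((upNbhd M p q (𝒜f : Set (Set α))).ncard : ℚ)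
      + ∑ Z ∈ 𝒜f, max 0 (phiK p q - ruleQRecv M p q Z) := by
  have h1 : phiK p q * (𝒜f.card : ℚ) = ∑ Z ∈ 𝒜f, phiK p q := by
    rw [Finset.sum_const, nsmul_eq_mul, mul_comm]
  have h2 : ∀ Z ∈ 𝒜f, phiK p q ≤ ruleQRecv M p q Z + max 0 (phiK p q - ruleQRecv M p q Z) := by
    intro Z _
    rcases le_total (phiK p q) (ruleQRecv M p q Z) with h | h
    · exact h.trans (le_add_of_nonneg_right (le_max_left _ _))
    · rw [max_eq_right (sub_nonneg.mpr h)]; linarith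
  calc phiK p q * (𝒜f.card : ℚ) = ∑ Z ∈ 𝒜f, phiK p q := h1
    _ ≤ ∑ Z ∈ 𝒜f, (ruleQRecv M p q Z + max 0 (phiK p q - ruleQRecv M p q Z)) := Finset.sum_le_sum h2
    _ = ∑ Z ∈ 𝒜f, ruleQRecv M p q Z + ∑ Z ∈ 𝒜f, max 0 (phiK p q - ruleQRecv M p q Z) := Finset.sum_add_distrib
    _ ≤ ((upNbhd M p q (𝒜f : Set (Set α))).ncard : ℚ) + ∑ Z ∈ 𝒜f, max 0 (phiK p q - ruleQRecv M p q Z) := by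
        gcongr
        exact sum_ruleQRecv_le_upNbhd M p q 𝒜f h𝒜

/-- **The deficit is confined to the slices `2 ≤ q − #P ≤ k − 3` on the families `2 ≤ k ≤ 7`**: for every finite family `𝒜f` of
members of the cell `(q+k, q)` at the tight layer, `Φ · #𝒜f ≤ #N⁺(𝒜f) + Σ_{Z ∈ 𝒜f, 2 ≤ q − #P ≤ k − 3} (Φ − recv(Z))₊` — the
members outside those slices contribute nothing (`ruleQRecv_ge_phiK_of_slice_le_seven`). -/
theorem hallUp_defect_slices {q k : ℕ} (hk2 : 2 ≤ k) (hk7 : k ≤ 7) (hE : M.E.ncard = (q + k) + q)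
    (𝒜f : Finset (Set α)) (h𝒜 : (𝒜f : Set (Set α)) ⊆ cellMembers M (q + k) q) :
    phiK (q + k) q * (𝒜f.card : ℚ) ≤ ((upNbhd M (q + k) q (𝒜f : Set (Set α))).ncard : ℚ)
      + ∑ Z ∈ 𝒜f.filter (fun Z => (flatPart M Z).ncard + 2 ≤ q ∧ q < (flatPart M Z).ncard + (k - 2)),
          max 0 (phiK (q + k) q - ruleQRecv M (q + k) q Z) := by
  classical
  refine (hallUp_defect M (q + k) q 𝒜f h𝒜).trans (add_le_add le_rfl ?_)
  rw [Finset.sum_filter]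
  refine Finset.sum_le_sum (fun Z hZ => ?_)
  split_ifs with hbad
  · exact le_rfl
  · -- outside the bad slices the member is paid, so its deficit is 0
    have hpaid : phiK (q + k) q ≤ ruleQRecv M (q + k) q Z :=
      ruleQRecv_ge_phiK_of_slice_le_seven M hk2 hk7 hE (h𝒜 (Finset.mem_coe.2 hZ)) (by omega)
    rw [max_eq_left (sub_nonpos.mpr hpaid)]

end PercRepro
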